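import Mathlib
import Summits.QuantumFields.YangMills.Theorems.MirrorModularBoostsHypercubicLimitOfLineInputs
import Summits.QuantumFields.YangMills.Theorems.MirrorModularBoostsHypercubicLimitCovBookkeeping
import Summits.QuantumFields.YangMills.Theorems.HypercubicLimit.Negative.TruncatedOSForm
import Literature.MathematicalPhysics.QuantumLattice.EuclideanAction
import HarnessLib

/-!
# `SelfNormalisedSkewness` — negative side: cumulant bookkeeping for the witness

Route `ScalingWindowSplit`, crux `stmt-QuantumFields-18944`, line `Sketch` (negation branch), support for the
lead's `stub_witnessAssembly`.  Pure bookkeeping, valid for every gauge group: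

* `thirdMoment_poly_eq_integral_centered` — on a probability space, for bounded measurable `X, Y, Z`,
  `E[XYZ] − E[X]E[YZ] − E[Y]E[XZ] − E[Z]E[XY] + 2E[X]E[Y]E[Z] = E[(X−EX)(Y−EY)(Z−EZ)]`;
* `kappa3_eq_cube_mul_integral_centered` — the crux's third-cumulant expression for ANY scheme equals `c_k³` times
  the third central moment of the BARE smeared fields (`c = 1`, `m = 0`): the renormalised field is affine in the
  bare one (`smearedLatticeField_affine`) and central moments are blind to additive constants;
* `centered_smearedLatticeField_eq_sum`, `integral_centered_mul_eq_sum`, `integral_centered_mul_mul_eq_sum` — the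
  bare centred smeared field is `a⁴ Σₓ w(a x) (Oₓ − E Oₓ)` and its second / third central moments are the
  `a⁸ ΣΣ` / `a¹² ΣΣΣ` sums of those of the site observables `Oₓ(U) = O(τₓ Ũ)`.

References: Glimm–Jaffe 1987 §6.1, §19.1 (truncated functions).  No definitions, no named facts.
-/

noncomputable section

open scoped SchwartzMap BigOperators
open MeasureTheory ProbabilityTheory Filter Topology
open Literature.MathematicalPhysics.QuantumLattice Literature.MathematicalPhysics.AQFT
  Literature.MathematicalPhysics.QuantumFieldTheory

namespace Summit.QuantumFields.YangMills.Theorems.SelfNormalisedSkewness.Negative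

/-- Affine renormalisation, pointwise (private copy of
`Theorems.ScalingWindowSplit.smearedLatticeField_affine`, inlined here so that this module no longer imports
`ScalingWindowSplitExistenceLegFromLattice`, whose closing theorem is red since the 2026-08-28T16:46Z re-render
of `Theses/ScalingWindowSplit`; ops-buildfix-2 gen 29, proof-only re-land). [folklore] -/
private theorem smearedLatticeField_affine_local {G : Type} [MeasurableSpace G] (O : LGConfig 4 G → ℝ)
    (Λ : Finset (Literature.Probability.LatticeModels.Site 4))
    (a c m : ℝ) (f : 𝓢(EuclideanSpace ℝ (Fin 4), ℝ)) (V : LGConfig 4 G) :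
    smearedLatticeField O Λ a c m f V =
      c * smearedLatticeField O Λ a 1 0 f V - c * a ^ 4 * ∑ x ∈ Λ, f (a • siteToE x) * m := by
  simp only [smearedLatticeField, one_mul, sub_zero, mul_sub, Finset.sum_sub_distrib]
  ring

section Abstract

variable {Ω : Type*} {mΩ : MeasurableSpace Ω} {μ : Measure Ω}

/-- A bounded measurable real function on a finite measure space is integrable. [folklore] -/
theorem integrable_of_abs_le_const [IsFiniteMeasure μ] {X : Ω → ℝ} (hX : Measurable X) {C : ℝ}
    (hC : ∀ ω, |X ω| ≤ C) : Integrable X μ :=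
  Integrable.of_bound hX.aestronglyMeasurable C (ae_of_all _ fun ω => by rw [Real.norm_eq_abs]; exact hC ω)

/-- **Third cumulant = third central moment** (three variables): on a probability space, for bounded
measurable `X, Y, Z`,
`E[XYZ] − E[X]E[YZ] − E[Y]E[XZ] − E[Z]E[XY] + 2E[X]E[Y]E[Z] = E[(X − EX)(Y − EY)(Z − EZ)]`. [folklore] -/
theorem thirdMoment_poly_eq_integral_centered [IsProbabilityMeasure μ] {X Y Z : Ω → ℝ}
    (hX : Measurable X) (hY : Measurable Y) (hZ : Measurable Z) {A B C : ℝ} (hA : ∀ ω, |X ω| ≤ A)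
    (hB : ∀ ω, |Y ω| ≤ B) (hC : ∀ ω, |Z ω| ≤ C) :
    (∫ ω, X ω * Y ω * Z ω ∂μ) - (∫ ω, X ω ∂μ) * (∫ ω, Y ω * Z ω ∂μ) - (∫ ω, Y ω ∂μ) * (∫ ω, X ω * Z ω ∂μ)
        - (∫ ω, Z ω ∂μ) * (∫ ω, X ω * Y ω ∂μ) + 2 * ((∫ ω, X ω ∂μ) * (∫ ω, Y ω ∂μ) * (∫ ω, Z ω ∂μ)) =
      ∫ ω, (X ω - ∫ ω', X ω' ∂μ) * (Y ω - ∫ ω', Y ω' ∂μ) * (Z ω - ∫ ω', Z ω' ∂μ) ∂μ := by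
  set a : ℝ := ∫ ω', X ω' ∂μ
  set b : ℝ := ∫ ω', Y ω' ∂μ
  set c : ℝ := ∫ ω', Z ω' ∂μ
  have iX : Integrable X μ := integrable_of_abs_le_const hX hA
  have iY : Integrable Y μ := integrable_of_abs_le_const hY hB
  have iZ : Integrable Z μ := integrable_of_abs_le_const hZ hC
  have bXY : ∀ ω, |X ω * Y ω| ≤ |A| * |B| := fun ω => by
    rw [abs_mul]
    exact mul_le_mul ((hA ω).trans (le_abs_self A)) ((hB ω).trans (le_abs_self B)) (abs_nonneg _)
      (abs_nonneg A)
  have iXY : Integrable (fun ω => X ω * Y ω) μ := integrable_of_abs_le_const (hX.mul hY) bXY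
  have iXZ : Integrable (fun ω => X ω * Z ω) μ :=
    integrable_of_abs_le_const (hX.mul hZ) (C := |A| * |C|) fun ω => by
      rw [abs_mul]
      exact mul_le_mul ((hA ω).trans (le_abs_self A)) ((hC ω).trans (le_abs_self C)) (abs_nonneg _)
        (abs_nonneg A)
  have iYZ : Integrable (fun ω => Y ω * Z ω) μ :=
    integrable_of_abs_le_const (hY.mul hZ) (C := |B| * |C|) fun ω => by
      rw [abs_mul]
      exact mul_le_mul ((hB ω).trans (le_abs_self B)) ((hC ω).trans (le_abs_self C)) (abs_nonneg _)
        (abs_nonneg B)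
  have iXYZ : Integrable (fun ω => X ω * Y ω * Z ω) μ :=
    integrable_of_abs_le_const ((hX.mul hY).mul hZ) (C := |A| * |B| * |C|) fun ω => by
      rw [abs_mul]
      exact mul_le_mul (bXY ω) ((hC ω).trans (le_abs_self C)) (abs_nonneg _) (by positivity)
  have hexp : ∀ ω, (X ω - a) * (Y ω - b) * (Z ω - c) =
      X ω * Y ω * Z ω - a * (Y ω * Z ω) - b * (X ω * Z ω) - c * (X ω * Y ω)
        + a * b * Z ω + a * c * Y ω + b * c * X ω - a * b * c := fun ω => by ring
  simp_rw [hexp]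
  have i1 : Integrable (fun ω => X ω * Y ω * Z ω - a * (Y ω * Z ω)) μ := iXYZ.sub (iYZ.const_mul a)
  have i2 : Integrable (fun ω => X ω * Y ω * Z ω - a * (Y ω * Z ω) - b * (X ω * Z ω)) μ :=
    i1.sub (iXZ.const_mul b)
  have i3 : Integrable (fun ω => X ω * Y ω * Z ω - a * (Y ω * Z ω) - b * (X ω * Z ω) - c * (X ω * Y ω)) μ :=
    i2.sub (iXY.const_mul c)
  have i4 : Integrable (fun ω => X ω * Y ω * Z ω - a * (Y ω * Z ω) - b * (X ω * Z ω) - c * (X ω * Y ω)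
      + a * b * Z ω) μ := i3.add (iZ.const_mul (a * b))
  have i5 : Integrable (fun ω => X ω * Y ω * Z ω - a * (Y ω * Z ω) - b * (X ω * Z ω) - c * (X ω * Y ω)
      + a * b * Z ω + a * c * Y ω) μ := i4.add (iY.const_mul (a * c))
  have i6 : Integrable (fun ω => X ω * Y ω * Z ω - a * (Y ω * Z ω) - b * (X ω * Z ω) - c * (X ω * Y ω)
      + a * b * Z ω + a * c * Y ω + b * c * X ω) μ := i5.add (iX.const_mul (b * c))
  rw [integral_sub i6 (integrable_const _), integral_add i5 (iX.const_mul _), integral_add i4 (iY.const_mul _),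
    integral_add i3 (iZ.const_mul _), integral_sub i2 (iXY.const_mul _), integral_sub i1 (iXZ.const_mul _),
    integral_sub iXYZ (iYZ.const_mul _), integral_const_mul, integral_const_mul, integral_const_mul,
    integral_const_mul, integral_const_mul, integral_const_mul, integral_const]
  simp only [probReal_univ, smul_eq_mul, one_mul]
  ring

end Abstract


section Scheme

/-- A smeared lattice field of a measurable observable, read on the periodic lift, is measurable in the torus
configuration. [folklore] -/
theorem witness_measurable_smeared {G : Type} [MeasurableSpace G] {O : LGConfig 4 G → ℝ} (hO : Measurable O)
    (Λ : Finset (Literature.Probability.LatticeModels.Site 4)) (a c m : ℝ)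
    (f : 𝓢(EuclideanSpace ℝ (Fin 4), ℝ)) (Sd : ℕ) :
    Measurable fun U : GaugeConfig 4 Sd G => smearedLatticeField O Λ a c m f (torusLift Sd U) := by
  unfold smearedLatticeField
  refine (Finset.measurable_sum _ fun x _ => ?_).const_mul _
  exact ((hO.comp ((configShift _).measurable.comp (measurable_torusLift _))).sub_const _).const_mul _

/-- A smeared lattice field of a bounded observable is bounded. [folklore] -/
theorem witness_abs_smeared_le {G : Type} [MeasurableSpace G] {O : LGConfig 4 G → ℝ} {C : ℝ}
    (hO : ∀ U, |O U| ≤ C)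
    (Λ : Finset (Literature.Probability.LatticeModels.Site 4)) (a c m : ℝ)
    (f : 𝓢(EuclideanSpace ℝ (Fin 4), ℝ)) (V : LGConfig 4 G) :
    |smearedLatticeField O Λ a c m f V| ≤ |c * a ^ 4| * ∑ x ∈ Λ, |f (a • siteToE x)| * (C + |m|) := by
  unfold smearedLatticeField
  rw [abs_mul]
  refine mul_le_mul_of_nonneg_left ((Finset.abs_sum_le_sum_abs _ _).trans
    (Finset.sum_le_sum fun x _ => ?_)) (abs_nonneg _)
  rw [abs_mul]
  exact mul_le_mul_of_nonneg_left ((abs_sub _ _).trans (add_le_add (hO _) le_rfl)) (abs_nonneg _)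

/-- **The crux's third-cumulant expression is `c_k³` times the third central moment of the BARE smeared
fields.**  For any scheme `S`, step `k`, and tests `f g h`, with `Φ₁(w)` the bare (`c = 1`, `m = 0`) smeared
curvature field on the torus of side `S.side k` and `μ_k = wilsonMeasure r.ρ (S.β k)`:
`𝔖₃(f,g,h) − 𝔖₁(f)𝔖₂(g,h) − 𝔖₁(g)𝔖₂(f,h) − 𝔖₁(h)𝔖₂(f,g) + 2𝔖₁(f)𝔖₁(g)𝔖₁(h)
  = c_k³ ∫ (Φ₁f − EΦ₁f)(Φ₁g − EΦ₁g)(Φ₁h − EΦ₁h) dμ_k`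
(the renormalised field is `c_k Φ₁ −` constant, `smearedLatticeField_affine`; third cumulants are central moments,
`thirdMoment_poly_eq_integral_centered`, hence blind to the constant). [cite: GlimmJaffe1987, §6.1 and §19.1] -/
theorem kappa3_eq_cube_mul_integral_centered {G : Type} [Group G] [TopologicalSpace G] [IsTopologicalGroup G]
    [CompactSpace G] [MeasurableSpace G] [BorelSpace G] (r : LatticeRep G) (S : SpeciesScheme (YMSpecies G)) (k : ℕ)
    (f g h : 𝓢(EuclideanSpace ℝ (Fin 4), ℝ)) :
    latticeSchwinger r.ρ S (fun s => s.F) k 3 (fun _ => r.curvature) ![f, g, h]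
        - latticeSchwinger r.ρ S (fun s => s.F) k 1 (fun _ => r.curvature) ![f] *
            latticeSchwinger r.ρ S (fun s => s.F) k 2 (fun _ => r.curvature) ![g, h]
        - latticeSchwinger r.ρ S (fun s => s.F) k 1 (fun _ => r.curvature) ![g] *
            latticeSchwinger r.ρ S (fun s => s.F) k 2 (fun _ => r.curvature) ![f, h]
        - latticeSchwinger r.ρ S (fun s => s.F) k 1 (fun _ => r.curvature) ![h] *
            latticeSchwinger r.ρ S (fun s => s.F) k 2 (fun _ => r.curvature) ![f, g]
        + 2 * (latticeSchwinger r.ρ S (fun s => s.F) k 1 (fun _ => r.curvature) ![f] *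
            latticeSchwinger r.ρ S (fun s => s.F) k 1 (fun _ => r.curvature) ![g] *
            latticeSchwinger r.ρ S (fun s => s.F) k 1 (fun _ => r.curvature) ![h]) =
      S.c r.curvature k ^ 3 *
        ∫ U, (smearedLatticeField r.curvature.F (Literature.Probability.LatticeModels.box 4 (S.L k)) (S.a k) 1 0 f
                (torusLift (S.side k) U) -
              ∫ U', smearedLatticeField r.curvature.F (Literature.Probability.LatticeModels.box 4 (S.L k)) (S.a k)
                1 0 f (torusLift (S.side k) U') ∂(wilsonMeasure r.ρ (S.β k))) *
            (smearedLatticeField r.curvature.F (Literature.Probability.LatticeModels.box 4 (S.L k)) (S.a k) 1 0 g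
                (torusLift (S.side k) U) -
              ∫ U', smearedLatticeField r.curvature.F (Literature.Probability.LatticeModels.box 4 (S.L k)) (S.a k)
                1 0 g (torusLift (S.side k) U') ∂(wilsonMeasure r.ρ (S.β k))) *
            (smearedLatticeField r.curvature.F (Literature.Probability.LatticeModels.box 4 (S.L k)) (S.a k) 1 0 h
                (torusLift (S.side k) U) -
              ∫ U', smearedLatticeField r.curvature.F (Literature.Probability.LatticeModels.box 4 (S.L k)) (S.a k)
                1 0 h (torusLift (S.side k) U') ∂(wilsonMeasure r.ρ (S.β k)))
          ∂(wilsonMeasure r.ρ (S.β k) : Measure (GaugeConfig 4 (S.side k) G)) := by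
  haveI : IsProbabilityMeasure (wilsonMeasure (d := 4) (L := S.side k) (G := G) r.ρ (S.β k)) :=
    isProbabilityMeasure_wilsonMeasure r.ρ r.continuous (S.β k)
  obtain ⟨C, hC⟩ := r.curvature.bounded
  set Λ := Literature.Probability.LatticeModels.box 4 (S.L k)
  set μ : Measure (GaugeConfig 4 (S.side k) G) := wilsonMeasure r.ρ (S.β k)
  set cc := S.c r.curvature k
  set mm := S.m r.curvature k
  have hLS3 : latticeSchwinger r.ρ S (fun s => s.F) k 3 (fun _ => r.curvature) ![f, g, h] =
      ∫ U, smearedLatticeField r.curvature.F Λ (S.a k) cc mm f (torusLift (S.side k) U) *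
        smearedLatticeField r.curvature.F Λ (S.a k) cc mm g (torusLift (S.side k) U) *
        smearedLatticeField r.curvature.F Λ (S.a k) cc mm h (torusLift (S.side k) U) ∂μ := by
    simp only [latticeSchwinger, Fin.prod_univ_three, Matrix.cons_val_zero, Matrix.cons_val_one,
      Matrix.cons_val]
    rfl
  have hLS2 : ∀ v w : 𝓢(EuclideanSpace ℝ (Fin 4), ℝ),
      latticeSchwinger r.ρ S (fun s => s.F) k 2 (fun _ => r.curvature) ![v, w] =
        ∫ U, smearedLatticeField r.curvature.F Λ (S.a k) cc mm v (torusLift (S.side k) U) *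
          smearedLatticeField r.curvature.F Λ (S.a k) cc mm w (torusLift (S.side k) U) ∂μ := fun v w => by
    simp only [latticeSchwinger, Fin.prod_univ_two, Matrix.cons_val_zero, Matrix.cons_val_one]
    rfl
  have hLS1 : ∀ v : 𝓢(EuclideanSpace ℝ (Fin 4), ℝ),
      latticeSchwinger r.ρ S (fun s => s.F) k 1 (fun _ => r.curvature) ![v] =
        ∫ U, smearedLatticeField r.curvature.F Λ (S.a k) cc mm v (torusLift (S.side k) U) ∂μ := fun v => by
    simp only [latticeSchwinger, Fin.prod_univ_one, Matrix.cons_val_fin_one]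
    rfl
  rw [hLS3, hLS2 g h, hLS2 f h, hLS2 f g, hLS1 f, hLS1 g, hLS1 h,
    thirdMoment_poly_eq_integral_centered (witness_measurable_smeared r.curvature.measurable Λ _ _ _ f _)
    (witness_measurable_smeared r.curvature.measurable Λ _ _ _ g _)
    (witness_measurable_smeared r.curvature.measurable Λ _ _ _ h _)
    (fun U => witness_abs_smeared_le hC Λ _ _ _ f _) (fun U => witness_abs_smeared_le hC Λ _ _ _ g _)
    (fun U => witness_abs_smeared_le hC Λ _ _ _ h _)]
  -- centre: the renormalised field minus its mean is `c` times the bare centred field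
  have hcentre : ∀ w : 𝓢(EuclideanSpace ℝ (Fin 4), ℝ), ∀ U : GaugeConfig 4 (S.side k) G,
      smearedLatticeField r.curvature.F Λ (S.a k) cc mm w (torusLift (S.side k) U) -
          ∫ U', smearedLatticeField r.curvature.F Λ (S.a k) cc mm w (torusLift (S.side k) U') ∂μ =
        cc * (smearedLatticeField r.curvature.F Λ (S.a k) 1 0 w (torusLift (S.side k) U) -
          ∫ U', smearedLatticeField r.curvature.F Λ (S.a k) 1 0 w (torusLift (S.side k) U') ∂μ) := by
    intro w U
    have hint : Integrable (fun U' : GaugeConfig 4 (S.side k) G =>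
        smearedLatticeField r.curvature.F Λ (S.a k) 1 0 w (torusLift (S.side k) U')) μ :=
      integrable_of_abs_le_const (witness_measurable_smeared r.curvature.measurable Λ _ _ _ w _)
        (fun U' => witness_abs_smeared_le hC Λ _ _ _ w _)
    simp only [smearedLatticeField_affine_local r.curvature.F Λ
      (S.a k) cc mm]
    rw [integral_sub (hint.const_mul _) (integrable_const _), integral_const_mul, integral_const,
      probReal_univ, one_smul]
    ring
  simp_rw [hcentre]
  rw [← integral_const_mul]
  refine integral_congr_ae (ae_of_all _ fun U => ?_)
  ring

end Scheme

/-! ### Site expansions of the bare centred smeared field -/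

section Sites

variable {G : Type} [MeasurableSpace G] {Sd : ℕ}

/-- **The bare centred smeared field is the smeared centred site field**:
`Φ₁(w)(U) − EΦ₁(w) = a⁴ Σₓ w(a x) (Oₓ(U) − E Oₓ)` with `Oₓ(U) = O(τₓ Ũ)`, for a bounded measurable observable `O`
under a probability measure on torus configurations. [folklore] -/
theorem centered_smearedLatticeField_eq_sum {O : LGConfig 4 G → ℝ} (hO : Measurable O) {C : ℝ}
    (hC : ∀ U, |O U| ≤ C) (Λ : Finset (Literature.Probability.LatticeModels.Site 4)) (a : ℝ)
    (w : 𝓢(EuclideanSpace ℝ (Fin 4), ℝ)) (μ : Measure (GaugeConfig 4 Sd G)) [IsProbabilityMeasure μ]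
    (U : GaugeConfig 4 Sd G) :
    smearedLatticeField O Λ a 1 0 w (torusLift Sd U) - ∫ U', smearedLatticeField O Λ a 1 0 w (torusLift Sd U') ∂μ =
      a ^ 4 * ∑ x ∈ Λ, w (a • siteToE x) *
        (O (configShift (-x) (torusLift Sd U)) - ∫ U', O (configShift (-x) (torusLift Sd U')) ∂μ) := by
  have hint : ∀ x : Literature.Probability.LatticeModels.Site 4,
      Integrable (fun U' : GaugeConfig 4 Sd G => O (configShift (-x) (torusLift Sd U'))) μ := fun x =>
    integrable_of_abs_le_const (hO.comp ((configShift _).measurable.comp (measurable_torusLift _)))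
      (fun U' => hC _)
  have hI : ∫ U', smearedLatticeField O Λ a 1 0 w (torusLift Sd U') ∂μ =
      a ^ 4 * ∑ x ∈ Λ, w (a • siteToE x) * ∫ U', O (configShift (-x) (torusLift Sd U')) ∂μ := by
    simp only [smearedLatticeField, one_mul, sub_zero]
    rw [integral_const_mul, integral_finsetSum _ fun x _ => (hint x).const_mul _]
    congr 1
    exact Finset.sum_congr rfl fun x _ => integral_const_mul _ _
  rw [hI]
  simp only [smearedLatticeField, one_mul, sub_zero]
  rw [← mul_sub, ← Finset.sum_sub_distrib]
  congr 1
  exact Finset.sum_congr rfl fun x _ => by ring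

/-- **Second central moment of the bare smeared field as a double site sum**:
`E[Φ̃₁(u) Φ̃₁(v)] = a⁸ ΣₓΣ_y u(a x) v(a y) E[Õₓ Õ_y]`, `Õₓ = Oₓ − E Oₓ`. [folklore] -/
theorem integral_centered_mul_eq_sum {O : LGConfig 4 G → ℝ} (hO : Measurable O) {C : ℝ}
    (hC : ∀ U, |O U| ≤ C) (Λ : Finset (Literature.Probability.LatticeModels.Site 4)) (a : ℝ)
    (u v : 𝓢(EuclideanSpace ℝ (Fin 4), ℝ)) (μ : Measure (GaugeConfig 4 Sd G)) [IsProbabilityMeasure μ] :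
    ∫ U, (smearedLatticeField O Λ a 1 0 u (torusLift Sd U) - ∫ U', smearedLatticeField O Λ a 1 0 u (torusLift Sd U') ∂μ) *
        (smearedLatticeField O Λ a 1 0 v (torusLift Sd U) - ∫ U', smearedLatticeField O Λ a 1 0 v (torusLift Sd U') ∂μ) ∂μ =
      a ^ 8 * ∑ x ∈ Λ, ∑ y ∈ Λ, u (a • siteToE x) * v (a • siteToE y) *
        ∫ U, (O (configShift (-x) (torusLift Sd U)) - ∫ U', O (configShift (-x) (torusLift Sd U')) ∂μ) *
          (O (configShift (-y) (torusLift Sd U)) - ∫ U', O (configShift (-y) (torusLift Sd U')) ∂μ) ∂μ := by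
  simp_rw [centered_smearedLatticeField_eq_sum hO hC Λ a _ μ]
  have hmeas : ∀ x : Literature.Probability.LatticeModels.Site 4,
      Measurable (fun U : GaugeConfig 4 Sd G =>
        O (configShift (-x) (torusLift Sd U)) - ∫ U', O (configShift (-x) (torusLift Sd U')) ∂μ) := fun x =>
    (hO.comp ((configShift _).measurable.comp (measurable_torusLift _))).sub_const _
  have hbdd : ∀ (x : Literature.Probability.LatticeModels.Site 4) (U : GaugeConfig 4 Sd G),
      |O (configShift (-x) (torusLift Sd U)) - ∫ U', O (configShift (-x) (torusLift Sd U')) ∂μ| ≤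
        |C| + |∫ U', O (configShift (-x) (torusLift Sd U')) ∂μ| := fun x U =>
    (abs_sub _ _).trans (add_le_add ((hC _).trans (le_abs_self C)) le_rfl)
  have hterm : ∀ x ∈ Λ, ∀ y ∈ Λ, Integrable (fun U : GaugeConfig 4 Sd G =>
      u (a • siteToE x) * v (a • siteToE y) *
        ((O (configShift (-x) (torusLift Sd U)) - ∫ U', O (configShift (-x) (torusLift Sd U')) ∂μ) *
          (O (configShift (-y) (torusLift Sd U)) - ∫ U', O (configShift (-y) (torusLift Sd U')) ∂μ))) μ := by
    intro x _ y _
    refine (integrable_of_abs_le_const ((hmeas x).mul (hmeas y))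
      (C := (|C| + |∫ U', O (configShift (-x) (torusLift Sd U')) ∂μ|) *
        (|C| + |∫ U', O (configShift (-y) (torusLift Sd U')) ∂μ|)) fun U => ?_).const_mul _
    rw [Pi.mul_apply, abs_mul]
    exact mul_le_mul (hbdd x U) (hbdd y U) (abs_nonneg _) (by positivity)
  have hexp : ∀ U : GaugeConfig 4 Sd G,
      (a ^ 4 * ∑ x ∈ Λ, u (a • siteToE x) *
          (O (configShift (-x) (torusLift Sd U)) - ∫ U', O (configShift (-x) (torusLift Sd U')) ∂μ)) *
        (a ^ 4 * ∑ y ∈ Λ, v (a • siteToE y) *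
          (O (configShift (-y) (torusLift Sd U)) - ∫ U', O (configShift (-y) (torusLift Sd U')) ∂μ)) =
      a ^ 8 * ∑ x ∈ Λ, ∑ y ∈ Λ, u (a • siteToE x) * v (a • siteToE y) *
        ((O (configShift (-x) (torusLift Sd U)) - ∫ U', O (configShift (-x) (torusLift Sd U')) ∂μ) *
          (O (configShift (-y) (torusLift Sd U)) - ∫ U', O (configShift (-y) (torusLift Sd U')) ∂μ)) := by
    intro U
    rw [mul_mul_mul_comm, Finset.sum_mul_sum, ← pow_add]
    congr 1
    refine Finset.sum_congr rfl fun x _ => Finset.sum_congr rfl fun y _ => by ring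
  simp_rw [hexp]
  rw [integral_const_mul, integral_finsetSum _ fun x hx => integrable_finsetSum _ fun y hy => hterm x hx y hy]
  congr 1
  refine Finset.sum_congr rfl fun x hx => ?_
  rw [integral_finsetSum _ fun y hy => hterm x hx y hy]
  exact Finset.sum_congr rfl fun y _ => integral_const_mul _ _

/-- **Third central moment of the bare smeared field as a triple site sum**:
`E[Φ̃₁(f) Φ̃₁(g) Φ̃₁(h)] = a¹² ΣₓΣ_yΣ_z f(a x) g(a y) h(a z) E[Õₓ Õ_y Õ_z]`. [folklore] -/
theorem integral_centered_mul_mul_eq_sum {O : LGConfig 4 G → ℝ} (hO : Measurable O) {C : ℝ}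
    (hC : ∀ U, |O U| ≤ C) (Λ : Finset (Literature.Probability.LatticeModels.Site 4)) (a : ℝ)
    (f g h : 𝓢(EuclideanSpace ℝ (Fin 4), ℝ)) (μ : Measure (GaugeConfig 4 Sd G)) [IsProbabilityMeasure μ] :
    ∫ U, (smearedLatticeField O Λ a 1 0 f (torusLift Sd U) - ∫ U', smearedLatticeField O Λ a 1 0 f (torusLift Sd U') ∂μ) *
        (smearedLatticeField O Λ a 1 0 g (torusLift Sd U) - ∫ U', smearedLatticeField O Λ a 1 0 g (torusLift Sd U') ∂μ) *
        (smearedLatticeField O Λ a 1 0 h (torusLift Sd U) - ∫ U', smearedLatticeField O Λ a 1 0 h (torusLift Sd U') ∂μ)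
        ∂μ =
      a ^ 12 * ∑ x ∈ Λ, ∑ y ∈ Λ, ∑ z ∈ Λ, f (a • siteToE x) * g (a • siteToE y) * h (a • siteToE z) *
        ∫ U, (O (configShift (-x) (torusLift Sd U)) - ∫ U', O (configShift (-x) (torusLift Sd U')) ∂μ) *
          (O (configShift (-y) (torusLift Sd U)) - ∫ U', O (configShift (-y) (torusLift Sd U')) ∂μ) *
          (O (configShift (-z) (torusLift Sd U)) - ∫ U', O (configShift (-z) (torusLift Sd U')) ∂μ) ∂μ := by
  simp_rw [centered_smearedLatticeField_eq_sum hO hC Λ a _ μ]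
  have hmeas : ∀ x : Literature.Probability.LatticeModels.Site 4,
      Measurable (fun U : GaugeConfig 4 Sd G =>
        O (configShift (-x) (torusLift Sd U)) - ∫ U', O (configShift (-x) (torusLift Sd U')) ∂μ) := fun x =>
    (hO.comp ((configShift _).measurable.comp (measurable_torusLift _))).sub_const _
  have hbdd : ∀ (x : Literature.Probability.LatticeModels.Site 4) (U : GaugeConfig 4 Sd G),
      |O (configShift (-x) (torusLift Sd U)) - ∫ U', O (configShift (-x) (torusLift Sd U')) ∂μ| ≤
        |C| + |∫ U', O (configShift (-x) (torusLift Sd U')) ∂μ| := fun x U =>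
    (abs_sub _ _).trans (add_le_add ((hC _).trans (le_abs_self C)) le_rfl)
  have hterm : ∀ x ∈ Λ, ∀ y ∈ Λ, ∀ z ∈ Λ, Integrable (fun U : GaugeConfig 4 Sd G =>
      f (a • siteToE x) * g (a • siteToE y) * h (a • siteToE z) *
        ((O (configShift (-x) (torusLift Sd U)) - ∫ U', O (configShift (-x) (torusLift Sd U')) ∂μ) *
          (O (configShift (-y) (torusLift Sd U)) - ∫ U', O (configShift (-y) (torusLift Sd U')) ∂μ) *
          (O (configShift (-z) (torusLift Sd U)) - ∫ U', O (configShift (-z) (torusLift Sd U')) ∂μ))) μ := by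
    intro x _ y _ z _
    refine (integrable_of_abs_le_const (((hmeas x).mul (hmeas y)).mul (hmeas z))
      (C := (|C| + |∫ U', O (configShift (-x) (torusLift Sd U')) ∂μ|) *
        (|C| + |∫ U', O (configShift (-y) (torusLift Sd U')) ∂μ|) *
        (|C| + |∫ U', O (configShift (-z) (torusLift Sd U')) ∂μ|)) fun U => ?_).const_mul _
    rw [Pi.mul_apply, Pi.mul_apply, abs_mul, abs_mul]
    exact mul_le_mul (mul_le_mul (hbdd x U) (hbdd y U) (abs_nonneg _) (by positivity)) (hbdd z U)
      (abs_nonneg _) (by positivity)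
  have hexp : ∀ U : GaugeConfig 4 Sd G,
      (a ^ 4 * ∑ x ∈ Λ, f (a • siteToE x) *
          (O (configShift (-x) (torusLift Sd U)) - ∫ U', O (configShift (-x) (torusLift Sd U')) ∂μ)) *
        (a ^ 4 * ∑ y ∈ Λ, g (a • siteToE y) *
          (O (configShift (-y) (torusLift Sd U)) - ∫ U', O (configShift (-y) (torusLift Sd U')) ∂μ)) *
        (a ^ 4 * ∑ z ∈ Λ, h (a • siteToE z) *
          (O (configShift (-z) (torusLift Sd U)) - ∫ U', O (configShift (-z) (torusLift Sd U')) ∂μ)) =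
      a ^ 12 * ∑ x ∈ Λ, ∑ y ∈ Λ, ∑ z ∈ Λ, f (a • siteToE x) * g (a • siteToE y) * h (a • siteToE z) *
        ((O (configShift (-x) (torusLift Sd U)) - ∫ U', O (configShift (-x) (torusLift Sd U')) ∂μ) *
          (O (configShift (-y) (torusLift Sd U)) - ∫ U', O (configShift (-y) (torusLift Sd U')) ∂μ) *
          (O (configShift (-z) (torusLift Sd U)) - ∫ U', O (configShift (-z) (torusLift Sd U')) ∂μ)) := by
    intro U
    have e : ∀ A B D : ℝ, a ^ 4 * A * (a ^ 4 * B) * (a ^ 4 * D) = a ^ 12 * (A * B * D) := fun A B D => by ring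
    rw [e, Finset.sum_mul_sum, Finset.sum_mul_sum]
    congr 1
    refine Finset.sum_congr rfl fun x _ => ?_
    rw [Finset.sum_comm]
    refine Finset.sum_congr rfl fun y _ => ?_
    rw [Finset.sum_mul]
    exact Finset.sum_congr rfl fun z _ => by ring
  simp_rw [hexp]
  rw [integral_const_mul, integral_finsetSum _ fun x hx => integrable_finsetSum _ fun y hy =>
    integrable_finsetSum _ fun z hz => hterm x hx y hy z hz]
  congr 1
  refine Finset.sum_congr rfl fun x hx => ?_
  rw [integral_finsetSum _ fun y hy => integrable_finsetSum _ fun z hz => hterm x hx y hy z hz]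
  refine Finset.sum_congr rfl fun y hy => ?_
  rw [integral_finsetSum _ fun z hz => hterm x hx y hy z hz]
  exact Finset.sum_congr rfl fun z _ => integral_const_mul _ _

end Sites


end Summit.QuantumFields.YangMills.Theorems.SelfNormalisedSkewness.Negative

end
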